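import Summits.CriticalPhenomena.PercolationContinuityZ3.Theorems.PercNearOneGluingNoHeavyLowerTailTwoAtomGlue
import HarnessLib

/-!
# `NoHeavyLowerTail` (stmt-CriticalPhenomena-4575) — merge-gain tools for the `2+2` kernel: Lemma 5 for one pair and the
# gain bookkeeping of a one-pair merge

Support file (lemma factory `prim-lf-3` gen 7, seat g9; `--supports stmt-CriticalPhenomena-4575`).  No definitions, no
named facts, no sorries.  Memo: `run/shared/lean/prim/prim-lf-3/LF3-BETA-R.md` §4, §6.

* `glue_pair_eq` — the clique-gluing of a two-element block `{x,y}` is the one-pair update `g[s(x,y) ↦ 1]`.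
* `real_openConn_pair_eq` — after gluing `s(x,y)`, `μ(x ↔ b) = μ(y ↔ b) = μ_g(x ↔ b ∪ y ↔ b)` (push-forward `ω ↦ ω ∪ {s(x,y)}`).
* `pairGlue_le` — KN Lemma 5 for a pair: `μ_g(j↔b) ≤ μ_g(c↔b)` ⟹ the same in `g[s(c,d) ↦ 1]` (`UpsetExchange.hubExchange_union`).
* `mergeGain_ge` — for `g⁺ := g[s(c,p₁) ↦ 1]`: `[(c−j)_{g⁺}] − [(c−j)_g] ≥ μ_g(p₁↔b, c↮b, j↮c) − μ_g(c↔b, p₁↮b, j↔p₁)`; combined with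
  `UpsetExchange.anchoredExchange` / `threeRelayExchange` this is the sign of every "merge gain" used in the kernel proofs.
-/

namespace Summit.CriticalPhenomena.PercolationContinuityZ3.Theorems

open MeasureTheory Set ProbabilityTheory
open Literature.Probability.LatticeModels
open Literature.Probability.Percolation

noncomputable section
open Classical

namespace UpsetExchange

variable {n : ℕ}

/-- Gluing a pair as "clique on a two-element block" is the one-pair update. [folklore] -/
theorem glue_pair_eq (g : Sym2 (Fin n) → unitInterval) {x y : Fin n} (hxy : x ≠ y) :
    (fun f : Sym2 (Fin n) => if (∀ z ∈ f, z ∈ ({x, y} : Finset (Fin n))) ∧ ¬ f.IsDiag then (1 : unitInterval) else g f) =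
      fun f => if f = s(x, y) then 1 else g f := by
  funext f
  by_cases hf : f = s(x, y)
  · rw [hf]
    have key : (∀ z ∈ s(x, y), z ∈ ({x, y} : Finset (Fin n))) ∧ ¬ (s(x, y)).IsDiag := by
      refine ⟨fun z hz => ?_, by rw [Sym2.mk_isDiag_iff]; exact hxy⟩
      rcases Sym2.mem_iff.1 hz with rfl | rfl <;> simp
    rw [if_pos key]
    simp
  · have hnot : ¬ ((∀ z ∈ f, z ∈ ({x, y} : Finset (Fin n))) ∧ ¬ f.IsDiag) := by
      rintro ⟨h1', h2'⟩
      apply hf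
      induction f using Sym2.ind with
      | h a c =>
        have ha := h1' a (Sym2.mem_mk_left a c)
        have hc := h1' c (Sym2.mem_mk_right a c)
        rw [Finset.mem_insert, Finset.mem_singleton] at ha hc
        rw [Sym2.mk_isDiag_iff] at h2'
        rw [Sym2.eq_iff]
        rcases ha with rfl | rfl <;> rcases hc with rfl | rfl
        · exact absurd rfl h2'
        · exact Or.inl ⟨rfl, rfl⟩
        · exact Or.inr ⟨rfl, rfl⟩
        · exact absurd rfl h2'
    simp only [if_neg hnot, if_neg hf]

/-- After gluing the pair `s(x,y)`, `x ↔ b` and `y ↔ b` have the same probability (both equal `μ_g(x ↔ b ∪ y ↔ b)`). [folklore] -/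
theorem real_openConn_pair_eq (g : Sym2 (Fin n) → unitInterval) {x y : Fin n} (hxy : x ≠ y) (b : Fin n) :
    (prodBernoulli (fun f : Sym2 (Fin n) => if f = s(x, y) then 1 else g f)).real (openConn x b) =
        (prodBernoulli g).real (openConn x b ∪ openConn y b) ∧
      (prodBernoulli (fun f : Sym2 (Fin n) => if f = s(x, y) then 1 else g f)).real (openConn y b) =
        (prodBernoulli g).real (openConn x b ∪ openConn y b) := by
  set e : Sym2 (Fin n) := s(x, y) with he
  set gp : Sym2 (Fin n) → unitInterval := fun f => if f = e then 1 else g f with hgp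
  have hpush : ∀ X : Set (BondConfig (Fin n)), (prodBernoulli gp).real X =
      (prodBernoulli g).real {ω | ((ω ∪ {e} : Set (Sym2 (Fin n))) : BondConfig (Fin n)) ∈ X} := by
    intro X
    exact glueSet_pushforward g gp {e} (fun f hf => by rw [mem_singleton_iff.1 hf]; simp [hgp])
      (fun f hf => by
        have hf' : f ≠ e := fun h => hf (h ▸ mem_singleton _)
        simp [hgp, hf']) X
  constructor
  · rw [hpush]; congr 1; ext ω
    simp only [mem_setOf_eq, mem_union]
    constructor
    · intro h
      rcases WeakestPort.reachable_union_pair (x := x) (y := y) (h : (openGraph _).Reachable x b) with h1 | ⟨-, h3⟩ | ⟨-, h3⟩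
      · exact Or.inl h1
      · exact Or.inr h3
      · exact Or.inl h3
    · rintro (h | h)
      · exact WeakestPort.reachable_union_pair_of hxy (Or.inl h)
      · exact WeakestPort.reachable_union_pair_of hxy (Or.inr (Or.inl ⟨SimpleGraph.Reachable.refl _, h⟩))
  · rw [hpush]; congr 1; ext ω
    simp only [mem_setOf_eq, mem_union]
    constructor
    · intro h
      rcases WeakestPort.reachable_union_pair (x := x) (y := y) (h : (openGraph _).Reachable y b) with h1 | ⟨-, h3⟩ | ⟨-, h3⟩
      · exact Or.inr h1
      · exact Or.inr h3
      · exact Or.inl h3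
    · rintro (h | h)
      · exact WeakestPort.reachable_union_pair_of hxy (Or.inr (Or.inr ⟨SimpleGraph.Reachable.refl _, h⟩))
      · exact WeakestPort.reachable_union_pair_of hxy (Or.inl h)

/-- **Lemma 5 for one pair.**  `μ_g(j ↔ b) ≤ μ_g(c ↔ b)` ⟹ the same after gluing the pair `s(c,d)` (with `c` still the reference).
[cite: KozmaNitzan2024, Lemma 5 (p. 13); VandenbergHaggstromKahn2005, Thm. 1.2] -/
theorem pairGlue_le (g : Sym2 (Fin n) → unitInterval) {c d : Fin n} (hcd : c ≠ d) (j b : Fin n)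
    (hle : (prodBernoulli g).real (openConn j b) ≤ (prodBernoulli g).real (openConn c b)) :
    (prodBernoulli (fun f : Sym2 (Fin n) => if f = s(c, d) then 1 else g f)).real (openConn j b) ≤
      (prodBernoulli (fun f : Sym2 (Fin n) => if f = s(c, d) then 1 else g f)).real (openConn c b) := by
  have hx := hubExchange_union g ({c, d} : Finset (Fin n)) j b c (by simp) ({∅} : Finset (Finset (Sym2 (Fin n))))
    (by simp) hle
  have hU : {ω : BondConfig (Fin n) | ∃ C ∈ ({∅} : Finset (Finset (Sym2 (Fin n)))), (↑C : Set (Sym2 (Fin n))) ⊆ ω} = univ := by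
    ext ω; simp
  rw [glue_pair_eq g hcd, hU, inter_univ, inter_univ] at hx
  exact hx

/-- **Merge-gain bookkeeping.**  `g⁺ := g[s(c,p₁) ↦ 1]`.  Then
`[(c−j)_{g⁺}] − [(c−j)_g] ≥ μ_g(p₁↔b, c↮b, j↮c) − μ_g(c↔b, p₁↮b, j↔p₁)` (the block gains `{p₁↔b, c↮b}`, the witness at most the two cross events). [folklore] -/
theorem mergeGain_ge (g : Sym2 (Fin n) → unitInterval) {c p₁ : Fin n} (hcp : c ≠ p₁) (j b : Fin n) :
    (prodBernoulli g).real (openConn p₁ b ∩ (openConn c b)ᶜ ∩ (openConn j c)ᶜ) -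
        (prodBernoulli g).real (openConn c b ∩ (openConn p₁ b)ᶜ ∩ openConn j p₁) ≤
      ((prodBernoulli (fun f : Sym2 (Fin n) => if f = s(c, p₁) then 1 else g f)).real (openConn c b) -
          (prodBernoulli (fun f : Sym2 (Fin n) => if f = s(c, p₁) then 1 else g f)).real (openConn j b)) -
        ((prodBernoulli g).real (openConn c b) - (prodBernoulli g).real (openConn j b)) := by
  set e : Sym2 (Fin n) := s(c, p₁) with he
  set gp : Sym2 (Fin n) → unitInterval := fun f => if f = e then 1 else g f with hgp
  have hpush : ∀ X : Set (BondConfig (Fin n)), (prodBernoulli gp).real X =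
      (prodBernoulli g).real {ω | ((ω ∪ {e} : Set (Sym2 (Fin n))) : BondConfig (Fin n)) ∈ X} := by
    intro X
    exact glueSet_pushforward g gp {e} (fun f hf => by rw [mem_singleton_iff.1 hf]; simp [hgp])
      (fun f hf => by
        have hf' : f ≠ e := fun h => hf (h ▸ mem_singleton _)
        simp [hgp, hf']) X
  have eC : (prodBernoulli gp).real (openConn c b) = (prodBernoulli g).real (openConn c b ∪ openConn p₁ b) :=
    (real_openConn_pair_eq g hcp b).1
  have hjb : {ω : BondConfig (Fin n) | ((ω ∪ {e} : Set (Sym2 (Fin n))) : BondConfig (Fin n)) ∈ (openConn j b : Set _)} =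
      openConn j b ∪ (openConn j c ∩ openConn p₁ b) ∪ (openConn j p₁ ∩ openConn c b) := by
    ext ω
    simp only [mem_setOf_eq, mem_union, mem_inter_iff]
    constructor
    · intro h
      rcases WeakestPort.reachable_union_pair (x := c) (y := p₁) (h : (openGraph _).Reachable j b) with h1 | ⟨h2, h3⟩ | ⟨h2, h3⟩
      · exact Or.inl (Or.inl h1)
      · exact Or.inl (Or.inr ⟨h2, h3⟩)
      · exact Or.inr ⟨h2, h3⟩
    · rintro ((h | ⟨h2, h3⟩) | ⟨h2, h3⟩)
      · exact WeakestPort.reachable_union_pair_of hcp (Or.inl h)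
      · exact WeakestPort.reachable_union_pair_of hcp (Or.inr (Or.inl ⟨h2, h3⟩))
      · exact WeakestPort.reachable_union_pair_of hcp (Or.inr (Or.inr ⟨h2, h3⟩))
  have eJ : (prodBernoulli gp).real (openConn j b) =
      (prodBernoulli g).real (openConn j b ∪ (openConn j c ∩ openConn p₁ b) ∪ (openConn j p₁ ∩ openConn c b)) := by
    rw [hpush, hjb]
  have hgainc : (prodBernoulli g).real (openConn c b ∪ openConn p₁ b) - (prodBernoulli g).real (openConn c b) =
      (prodBernoulli g).real (openConn p₁ b ∩ (openConn c b)ᶜ) := by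
    have := measureReal_union_add_inter (μ := prodBernoulli g) (s := openConn p₁ b)
      (MeasurableSet.of_discrete : MeasurableSet (openConn c b : Set (BondConfig (Fin n))))
    have h2 := measureReal_inter_add_sdiff (μ := prodBernoulli g) (s := openConn p₁ b)
      (MeasurableSet.of_discrete : MeasurableSet (openConn c b : Set (BondConfig (Fin n)))) (measure_ne_top _ _)
    have h3 : (openConn p₁ b : Set (BondConfig (Fin n))) \ openConn c b = openConn p₁ b ∩ (openConn c b)ᶜ := by
      ext ω; simp [mem_sdiff]
    rw [union_comm] at this
    rw [h3] at h2
    linarith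
  have hgainj : (prodBernoulli g).real (openConn j b ∪ (openConn j c ∩ openConn p₁ b) ∪ (openConn j p₁ ∩ openConn c b)) -
      (prodBernoulli g).real (openConn j b) ≤
      (prodBernoulli g).real ((openConn j c ∩ openConn p₁ b) ∩ (openConn j b)ᶜ) +
        (prodBernoulli g).real ((openConn j p₁ ∩ openConn c b) ∩ (openConn j b)ᶜ) := by
    have hsub : (openConn j b ∪ (openConn j c ∩ openConn p₁ b) ∪ (openConn j p₁ ∩ openConn c b) : Set (BondConfig (Fin n))) ⊆
        openConn j b ∪ (((openConn j c ∩ openConn p₁ b) ∩ (openConn j b)ᶜ) ∪ ((openConn j p₁ ∩ openConn c b) ∩ (openConn j b)ᶜ)) := by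
      intro ω hω
      by_cases h : ω ∈ (openConn j b : Set (BondConfig (Fin n)))
      · exact Or.inl h
      · rcases hω with (h1' | h2') | h3'
        · exact Or.inl h1'
        · exact Or.inr (Or.inl ⟨h2', h⟩)
        · exact Or.inr (Or.inr ⟨h3', h⟩)
    have m1 := measureReal_mono hsub (measure_ne_top (prodBernoulli g) _)
    have m2 := measureReal_union_le (μ := prodBernoulli g) (openConn j b : Set (BondConfig (Fin n)))
      (((openConn j c ∩ openConn p₁ b) ∩ (openConn j b)ᶜ) ∪ ((openConn j p₁ ∩ openConn c b) ∩ (openConn j b)ᶜ))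
    have m3 := measureReal_union_le (μ := prodBernoulli g) ((openConn j c ∩ openConn p₁ b) ∩ (openConn j b)ᶜ : Set (BondConfig (Fin n)))
      ((openConn j p₁ ∩ openConn c b) ∩ (openConn j b)ᶜ)
    linarith
  have hE1 : (prodBernoulli g).real (openConn p₁ b ∩ (openConn c b)ᶜ) -
      (prodBernoulli g).real ((openConn j c ∩ openConn p₁ b) ∩ (openConn j b)ᶜ) =
      (prodBernoulli g).real (openConn p₁ b ∩ (openConn c b)ᶜ ∩ (openConn j c)ᶜ) := by
    have h2 := measureReal_inter_add_sdiff (μ := prodBernoulli g) (s := openConn p₁ b ∩ (openConn c b)ᶜ)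
      (MeasurableSet.of_discrete : MeasurableSet (openConn j c : Set (BondConfig (Fin n)))) (measure_ne_top _ _)
    have hA : (openConn p₁ b ∩ (openConn c b)ᶜ : Set (BondConfig (Fin n))) ∩ openConn j c =
        (openConn j c ∩ openConn p₁ b) ∩ (openConn j b)ᶜ := by
      ext ω
      simp only [mem_inter_iff, mem_compl_iff]
      constructor
      · rintro ⟨⟨hpb, hncb⟩, hjc⟩
        refine ⟨⟨hjc, hpb⟩, fun hjb' => hncb ?_⟩
        exact (hjc : (openGraph ω).Reachable j c).symm.trans hjb'
      · rintro ⟨⟨hjc, hpb⟩, hnjb⟩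
        refine ⟨⟨hpb, fun hcb' => hnjb ?_⟩, hjc⟩
        exact (hjc : (openGraph ω).Reachable j c).trans hcb'
    have hB : (openConn p₁ b ∩ (openConn c b)ᶜ : Set (BondConfig (Fin n))) \ openConn j c =
        openConn p₁ b ∩ (openConn c b)ᶜ ∩ (openConn j c)ᶜ := by
      ext ω; simp [mem_sdiff, mem_inter_iff]
    rw [hA, hB] at h2
    linarith
  have hE2 : (prodBernoulli g).real ((openConn j p₁ ∩ openConn c b) ∩ (openConn j b)ᶜ) =
      (prodBernoulli g).real (openConn c b ∩ (openConn p₁ b)ᶜ ∩ openConn j p₁) := by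
    congr 1
    ext ω
    simp only [mem_inter_iff, mem_compl_iff]
    constructor
    · rintro ⟨⟨hjp, hcb'⟩, hnjb⟩
      refine ⟨⟨hcb', fun hpb => hnjb ?_⟩, hjp⟩
      exact (hjp : (openGraph ω).Reachable j p₁).trans hpb
    · rintro ⟨⟨hcb', hnpb⟩, hjp⟩
      refine ⟨⟨hjp, hcb'⟩, fun hjb' => hnpb ?_⟩
      exact (hjp : (openGraph ω).Reachable j p₁).symm.trans hjb'
  rw [eC, eJ]
  linarith [hgainc, hgainj, hE1, hE2]


end UpsetExchange

end

end Summit.CriticalPhenomena.PercolationContinuityZ3.Theorems
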